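import Summits.HubbardSuperconductivity.HubbardSuperconductivity.Theorems.AnisotropyChordStiffnessReflection
import Summits.HubbardSuperconductivity.HubbardSuperconductivity.Theorems.AnisotropyChordStiffnessOneState

/-!
# Route `AnisotropyChord` / H0 rotor rung: the helicity TENSOR hypothesis (S_Υ) from PER-AXIS twist stiffness
# (theory seat memo ROTOR-THEORY-8 §118 (D2), work-order W10): the off-diagonal current–current kernel vanishes by
# reflection symmetry

For a Perron sector ground amplitude `ψ` of `H(Δ)` on `(ℤ/L)²` (`L ≥ 2`), with `c^j_i = ⟨vᵢ, J^j_0 ψ⟩` the uniform-current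
amplitudes and `ωᵢ` the excitation energies:
* `spectralSum_eq_form` : `Σᵢ g(λᵢ) conj⟨vᵢ,w⟩ ⟨vᵢ,w'⟩ = ⟨w, p(H) w'⟩` for any polynomial `p` with `p(λᵢ) = g(λᵢ)`
  (completeness + reality of `H`);
* **`crossKernel_eq_zero`** : `K_{01} := Σᵢ c⁰ᵢ conj(c¹ᵢ)/ωᵢ = 0` — the axis reflection `Θ` (`x₁ ↦ −x₁`) fixes `ψ` and `H`,
  commutes with `p(H)`, fixes `J⁰_0 ψ` and negates `J¹_0 ψ`, so `K_{01} = −K_{01}`;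
* **`helicityTensor_of_axial`** : the per-axis spectral stiffness bounds `2 Σᵢ |c^j_i|²/ωᵢ ≤ ⟨−T_j⟩ − Υ₀L²` (`j = 0,1`)
  give the tensor bound `2 Σᵢ |Σ_j ε_j c^j_i|²/ωᵢ ≤ Σ_j |ε_j|² (⟨−T_j⟩ − Υ₀L²)` for every `ε ∈ ℂ²`;
* typed **(S_tw, both axes) `AxialTwistStiffness Δ M`** / `AxialTwistStiffnessN Δ M` (uniform Drude/twist stiffness in
  EACH lattice direction, spectral form) and the links `uniformHelicityTensor_of_axial`, `uniformHelicityTensorN_of_axialN`;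
* END-TO-END corollaries with the per-axis hypothesis: `eventualCondensate_of_axial_stiffness_densityResponse`
  (two-state chain) and **`eventualCondensate_of_oneState_axial`** (one-state chain).
The variational phrasing of per-axis stiffness (`UniformTwistStiffness` of `…StiffnessDefs`, axis `0`) implies the spectral
one by the variational characterisation of `m₋₁`; that step is not repeated here.
-/

set_option linter.dupNamespace false

noncomputable section

open Matrix Complex Finset Filter Topology Polynomial
open scoped ComplexConjugate
open Literature.MathematicalPhysics.QuantumLattice hiding torusPhase torusNorm
open Literature.Probability.LatticeModels
open Summit.HubbardSuperconductivity.HubbardSuperconductivity.Theorems.AnisotropyChord.InsertionEntropy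

namespace Summit.HubbardSuperconductivity.HubbardSuperconductivity.Theorems.AnisotropyChord.Stiffness

variable {L : ℕ} [NeZero L]

/-! ## Spectral sums as polynomial forms -/

/-- **Spectral sums are matrix-polynomial forms:** if `p(λᵢ) = gᵢ` on the spectrum of the (real symmetric) `H(Δ)`, then
`Σᵢ gᵢ · conj⟨vᵢ, w⟩ · ⟨vᵢ, w'⟩ = ⟨w, p(H) w'⟩`. [folklore] -/
theorem spectralSum_eq_form (Δ : ℝ) (p : ℂ[X]) (g : TensorIndex (TorusSite 2 L) 2 → ℂ)
    (hp : ∀ i, p.eval (((hcbHamiltonian_isHermitian L Δ).eigenvalues i : ℝ) : ℂ) = g i)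
    (w w' : TensorIndex (TorusSite 2 L) 2 → ℂ) :
    ∑ i, g i * (starRingEnd ℂ) (star (⇑((hcbHamiltonian_isHermitian L Δ).eigenvectorBasis i)) ⬝ᵥ w)
        * (star (⇑((hcbHamiltonian_isHermitian L Δ).eigenvectorBasis i)) ⬝ᵥ w')
      = star w ⬝ᵥ (aeval (hcbHamiltonian L Δ) p *ᵥ w') := by
  set hH := hcbHamiltonian_isHermitian L Δ
  have hcomp := sum_dotProduct_mulVec_mul_dotProduct hH 1 w (aeval (hcbHamiltonian L Δ) p *ᵥ w')
  simp only [Matrix.one_mulVec] at hcomp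
  rw [← hcomp]
  refine Finset.sum_congr rfl fun i _ => ?_
  have hPt : (aeval (hcbHamiltonian L Δ) p)ᵀ = aeval (hcbHamiltonian L Δ) p := by
    rw [transpose_aeval, xxz_transpose_eq]
  have heig : hcbHamiltonian L Δ *ᵥ ⇑(hH.eigenvectorBasis i) = ((hH.eigenvalues i : ℝ) : ℂ) • ⇑(hH.eigenvectorBasis i) := by
    rw [hH.mulVec_eigenvectorBasis i]; funext σ; simp [Pi.smul_apply]
  have hstar := star_eigenvector_mulVec (hcbHamiltonian L Δ) (xxz_entry_real Δ) heig
  have h1 : star (⇑(hH.eigenvectorBasis i)) ⬝ᵥ (aeval (hcbHamiltonian L Δ) p *ᵥ w')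
      = g i * (star (⇑(hH.eigenvectorBasis i)) ⬝ᵥ w') := by
    rw [dotProduct_mulVec, ← Matrix.mulVec_transpose, hPt, aeval_mulVec_of_eigen _ p hstar, hp i,
      smul_dotProduct, smul_eq_mul]
  rw [h1, Matrix.star_dotProduct (⇑(hH.eigenvectorBasis i)) w, ← RCLike.star_def, star_star]
  ring

/-! ## The off-diagonal current kernel vanishes -/

/-- **`K_{01} = 0` (reflection symmetry; memo ROTOR-THEORY-8 §118 (D2)).**  For a Perron sector ground amplitude of
`H(Δ)` on `(ℤ/L)²`, `L ≥ 2`:  `Σᵢ ⟨vᵢ, J⁰_0 ψ⟩ conj⟨vᵢ, J¹_0 ψ⟩ / ωᵢ = 0` — the reflection `x₁ ↦ −x₁` fixes `ψ`, commutes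
with every polynomial in `H`, fixes `J⁰_0 ψ` and negates `J¹_0 ψ`. [folklore] -/
theorem crossKernel_eq_zero (hL : 2 ≤ L) (Δ M : ℝ) (a : TensorIndex (TorusSite 2 L) 2 → ℝ)
    (ha : IsPerronSectorGroundAmplitude L Δ M a) :
    ∑ i, currentAmp L Δ a 0 0 i * (starRingEnd ℂ) (currentAmp L Δ a 0 1 i)
        * (((1 / excitation L Δ M i : ℝ)) : ℂ) = 0 := by
  classical
  -- Lagrange interpolation of `λ ↦ 1/(λ − E₀)` on the spectrum
  obtain ⟨p, hp⟩ : ∃ p : ℂ[X], ∀ i, p.eval (((hcbHamiltonian_isHermitian L Δ).eigenvalues i : ℝ) : ℂ)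
      = (((1 / excitation L Δ M i : ℝ)) : ℂ) := by
    set hH := hcbHamiltonian_isHermitian L Δ
    set S : Finset ℂ := Finset.univ.image fun i => ((hH.eigenvalues i : ℝ) : ℂ) with hS
    refine ⟨Lagrange.interpolate S id fun z =>
      (((1 / (z.re - lowestEnergyInSector 1 (hcbHamiltonian L Δ) M) : ℝ)) : ℂ), fun i => ?_⟩
    have hi : ((hH.eigenvalues i : ℝ) : ℂ) ∈ S := Finset.mem_image.mpr ⟨i, Finset.mem_univ _, rfl⟩
    have h := Lagrange.eval_interpolate_at_node (v := id)
      (fun z => (((1 / (z.re - lowestEnergyInSector 1 (hcbHamiltonian L Δ) M) : ℝ)) : ℂ)) (Set.injOn_id _) hi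
    rw [id] at h
    rw [h, Complex.ofReal_re]
    rfl
  -- the kernel as a form `⟨J¹ψ, p(H) J⁰ψ⟩`
  have hform : ∑ i, currentAmp L Δ a 0 0 i * (starRingEnd ℂ) (currentAmp L Δ a 0 1 i)
        * (((1 / excitation L Δ M i : ℝ)) : ℂ)
      = star (currentMode L 0 1 *ᵥ toC L a)
          ⬝ᵥ (aeval (hcbHamiltonian L Δ) p *ᵥ (currentMode L 0 0 *ᵥ toC L a)) := by
    rw [← spectralSum_eq_form Δ p _ hp]
    unfold currentAmp
    refine Finset.sum_congr rfl fun i _ => ?_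
    ring
  rw [hform]
  -- the reflection `Θ`: `Θψ = ψ`, `Θ J⁰_0 ψ = J⁰_0 ψ`, `Θ J¹_0 ψ = −J¹_0 ψ`, `Θ p(H) = p(H) Θ`, `Θ` unitary
  have hψ : configPull (axisFlip L) (toC L a) = toC L a := by
    have h := configPull_toC_perron Δ M a ha (axisFlipIso L)
    rw [axisFlipIso_toEquiv] at h
    exact h
  have h0 : configPull (axisFlip L) (currentMode L 0 0 *ᵥ toC L a) = currentMode L 0 0 *ᵥ toC L a := by
    rw [configPull_currentMode_axis0 hL, hψ]
  have h1 : configPull (axisFlip L) (currentMode L 0 1 *ᵥ toC L a) = -(currentMode L 0 1 *ᵥ toC L a) := by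
    rw [configPull_currentMode_axis1 hL, hψ]
  have hPx : configPull (axisFlip L) (aeval (hcbHamiltonian L Δ) p *ᵥ (currentMode L 0 0 *ᵥ toC L a))
      = aeval (hcbHamiltonian L Δ) p *ᵥ (currentMode L 0 0 *ᵥ toC L a) := by
    have h := aeval_mulVec_configPull Δ (axisFlipIso L) p (currentMode L 0 0 *ᵥ toC L a)
    rw [axisFlipIso_toEquiv, h0] at h
    exact h.symm
  have key := dotProduct_configPull (axisFlip L) (currentMode L 0 1 *ᵥ toC L a)
    (aeval (hcbHamiltonian L Δ) p *ᵥ (currentMode L 0 0 *ᵥ toC L a))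
  rw [h1, hPx, star_neg, neg_dotProduct] at key
  linear_combination (-(1 / 2 : ℂ)) * key

/-! ## From per-axis stiffness to the helicity tensor -/

/-- `‖ε₀c₀ + ε₁c₁‖² = |ε₀|²|c₀|² + |ε₁|²|c₁|² + 2 Re(ε₀ conj ε₁ · c₀ conj c₁)`. [folklore] -/
theorem norm_sq_lin_two (ε₀ ε₁ c₀ c₁ : ℂ) :
    ‖ε₀ * c₀ + ε₁ * c₁‖ ^ 2
      = ‖ε₀‖ ^ 2 * ‖c₀‖ ^ 2 + ‖ε₁‖ ^ 2 * ‖c₁‖ ^ 2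
        + 2 * (ε₀ * (starRingEnd ℂ) ε₁ * (c₀ * (starRingEnd ℂ) c₁)).re := by
  rw [Complex.sq_norm, Complex.normSq_add, Complex.normSq_eq_norm_sq, Complex.normSq_eq_norm_sq, norm_mul,
    norm_mul, mul_pow, mul_pow, map_mul]
  congr 2
  ring

omit [NeZero L] in
/-- Real part against a real weight: `(z · r).re = z.re · r`. [folklore] -/
theorem re_mul_ofReal' (z : ℂ) (r : ℝ) : (z * (r : ℂ)).re = z.re * r := by
  simp [Complex.mul_re]

/-- **(S_tw on both axes) ⇒ (S_Υ) at fixed `L` (PROVED):** per-axis spectral twist stiffness gives the helicity-TENSOR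
bound for every polarisation `ε ∈ ℂ²`, the cross term vanishing by `crossKernel_eq_zero`. [folklore] -/
theorem helicityTensor_of_axial (hL : 2 ≤ L) (Δ M : ℝ) (a : TensorIndex (TorusSite 2 L) 2 → ℝ)
    (ha : IsPerronSectorGroundAmplitude L Δ M a) (Υ₀ : ℝ)
    (hS : ∀ j : Fin 2, 2 * ∑ i, ‖currentAmp L Δ a 0 j i‖ ^ 2 / excitation L Δ M i
      ≤ kineticExpect L a j - Υ₀ * (L : ℝ) ^ 2)
    (ε : Fin 2 → ℂ) :
    2 * ∑ i, ‖∑ j, ε j * currentAmp L Δ a 0 j i‖ ^ 2 / excitation L Δ M i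
      ≤ ∑ j, ‖ε j‖ ^ 2 * (kineticExpect L a j - Υ₀ * (L : ℝ) ^ 2) := by
  have hK := crossKernel_eq_zero hL Δ M a ha
  -- termwise expansion
  have hexp : ∀ i, ‖∑ j, ε j * currentAmp L Δ a 0 j i‖ ^ 2 / excitation L Δ M i
      = ‖ε 0‖ ^ 2 * (‖currentAmp L Δ a 0 0 i‖ ^ 2 / excitation L Δ M i)
        + ‖ε 1‖ ^ 2 * (‖currentAmp L Δ a 0 1 i‖ ^ 2 / excitation L Δ M i)
        + 2 * ((ε 0 * (starRingEnd ℂ) (ε 1)) * (currentAmp L Δ a 0 0 i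
            * (starRingEnd ℂ) (currentAmp L Δ a 0 1 i) * (((1 / excitation L Δ M i : ℝ)) : ℂ))).re := by
    intro i
    rw [Fin.sum_univ_two, norm_sq_lin_two]
    have hre : ((ε 0 * (starRingEnd ℂ) (ε 1)) * (currentAmp L Δ a 0 0 i
            * (starRingEnd ℂ) (currentAmp L Δ a 0 1 i) * (((1 / excitation L Δ M i : ℝ)) : ℂ))).re
        = (ε 0 * (starRingEnd ℂ) (ε 1) * (currentAmp L Δ a 0 0 i * (starRingEnd ℂ) (currentAmp L Δ a 0 1 i))).re
            * (1 / excitation L Δ M i) := by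
      rw [← re_mul_ofReal']
      congr 1
      ring
    rw [hre]
    ring
  -- the cross terms sum to zero
  have hC : ∑ i, 2 * ((ε 0 * (starRingEnd ℂ) (ε 1)) * (currentAmp L Δ a 0 0 i
      * (starRingEnd ℂ) (currentAmp L Δ a 0 1 i) * (((1 / excitation L Δ M i : ℝ)) : ℂ))).re = 0 := by
    rw [← Finset.mul_sum, ← Complex.re_sum, ← Finset.mul_sum, hK, mul_zero, Complex.zero_re, mul_zero]
  have hsum : 2 * ∑ i, ‖∑ j, ε j * currentAmp L Δ a 0 j i‖ ^ 2 / excitation L Δ M i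
      = ‖ε 0‖ ^ 2 * (2 * ∑ i, ‖currentAmp L Δ a 0 0 i‖ ^ 2 / excitation L Δ M i)
        + ‖ε 1‖ ^ 2 * (2 * ∑ i, ‖currentAmp L Δ a 0 1 i‖ ^ 2 / excitation L Δ M i) := by
    rw [Finset.sum_congr rfl fun i _ => hexp i, Finset.sum_add_distrib, Finset.sum_add_distrib, hC, add_zero,
      ← Finset.mul_sum, ← Finset.mul_sum]
    ring
  rw [hsum, Fin.sum_univ_two]
  have h0 := mul_le_mul_of_nonneg_left (hS 0) (sq_nonneg ‖ε 0‖)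
  have h1 := mul_le_mul_of_nonneg_left (hS 1) (sq_nonneg ‖ε 1‖)
  linarith

/-! ## The per-axis hypothesis, typed, and the links -/

/-- **HYPOTHESIS (S_tw, both axes) — `AxialTwistStiffness`** (uniform Drude/twist stiffness in EACH lattice direction,
spectral form): there is `Υ₀ > 0` such that, eventually in `L`, for the Perron reference amplitude of sector `M_L − 1` and
each axis `j`, `2 Σᵢ |⟨vᵢ, J^j_0 ψ⟩|²/ωᵢ ≤ ⟨−T_j⟩ − Υ₀ L²`, i.e. `Υ^j_L := (⟨−T_j⟩ − 2m₋₁(J^j_0))/L² ≥ Υ₀` (`= ∂²_θ E/L²`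
under a twist of axis `j`).  No cross-axis condition: the off-diagonal kernel vanishes by reflection symmetry
(`crossKernel_eq_zero`).  ED (kit j298465): `Υ_tw/t = 0.985–0.999` per axis.
[conjecture: theory seat hubbard-h0-rotor-theory-1, cycle 8, 2026-08-28 — hypothesis (S_tw) of H0 for both axes (memo ROTOR-THEORY-8 §103 (iv), §118 (D2))] -/
def AxialTwistStiffness (Δ : ℝ) (M : ℕ → ℝ) : Prop :=
  ∃ Υ₀ > (0 : ℝ), ∀ᶠ L : ℕ in atTop, ∀ [NeZero L],
    ∀ a : TensorIndex (TorusSite 2 L) 2 → ℝ, IsPerronSectorGroundAmplitude L Δ (M L - 1) a →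
      ∀ j : Fin 2, 2 * ∑ i, ‖currentAmp L Δ a 0 j i‖ ^ 2 / excitation L Δ (M L - 1) i
        ≤ kineticExpect L a j - Υ₀ * (L : ℝ) ^ 2

/-- **HYPOTHESIS (S_tw, both axes)^N — `AxialTwistStiffnessN`**: the same for the Perron amplitude of the sector `M_L`
itself (one-state chain). [conjecture: theory seat hubbard-h0-rotor-theory-1, cycle 9, 2026-08-28 — hypothesis (S_tw) of H0, both axes, N-sector form] -/
def AxialTwistStiffnessN (Δ : ℝ) (M : ℕ → ℝ) : Prop :=
  ∃ Υ₀ > (0 : ℝ), ∀ᶠ L : ℕ in atTop, ∀ [NeZero L],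
    ∀ a : TensorIndex (TorusSite 2 L) 2 → ℝ, IsPerronSectorGroundAmplitude L Δ (M L) a →
      ∀ j : Fin 2, 2 * ∑ i, ‖currentAmp L Δ a 0 j i‖ ^ 2 / excitation L Δ (M L) i
        ≤ kineticExpect L a j - Υ₀ * (L : ℝ) ^ 2

/-- **(S_tw, both axes) ⇒ (S_Υ) (PROVED).** [folklore] -/
theorem uniformHelicityTensor_of_axial (Δ : ℝ) (M : ℕ → ℝ) (h : AxialTwistStiffness Δ M) :
    UniformHelicityTensor Δ M := by
  obtain ⟨Υ₀, hΥ₀, hev⟩ := h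
  refine ⟨Υ₀, hΥ₀, ?_⟩
  filter_upwards [hev, eventually_ge_atTop 2] with L hL h2
  intro _ a ha ε
  exact helicityTensor_of_axial h2 Δ (M L - 1) a ha Υ₀ (hL a ha) ε

/-- **(S_tw, both axes)^N ⇒ (S_Υ)^N (PROVED).** [folklore] -/
theorem uniformHelicityTensorN_of_axialN (Δ : ℝ) (M : ℕ → ℝ) (h : AxialTwistStiffnessN Δ M) :
    UniformHelicityTensorN Δ M := by
  obtain ⟨Υ₀, hΥ₀, hev⟩ := h
  refine ⟨Υ₀, hΥ₀, ?_⟩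
  filter_upwards [hev, eventually_ge_atTop 2] with L hL h2
  intro _ a ha ε
  exact helicityTensor_of_axial h2 Δ (M L) a ha Υ₀ (hL a ha) ε

/-- **THE H0 ROTOR RUNG WITH PER-AXIS STIFFNESS (two-state chain):** «uniform twist stiffness in both lattice directions
(S_tw) + bounded density response (K′) + infrared Gaussianity of the insertion law (H1′) ⇒ BEC» on the density window —
`eventualCondensate_of_stiffness_densityResponse` with the tensor hypothesis discharged by reflection symmetry. [folklore] -/
theorem eventualCondensate_of_axial_stiffness_densityResponse (Δ : ℝ) (M : ℕ → ℝ) (ρ : ℝ)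
    (hρ : ρ ∈ Set.Ioo (0 : ℝ) 1)
    (hlim : Tendsto (fun L : ℕ => 1 / 2 + M L / (L : ℝ) ^ 2) atTop (nhds ρ))
    (hsect : ∀ᶠ L : ℕ in atTop, ∀ [NeZero L], spinZSector (Λ := TorusSite 2 L) 1 (M L - 1) ≠ ⊥)
    (hS : AxialTwistStiffness Δ M) (hK : BoundedDensityResponse Δ M)
    (hG : GaussianInsertionComparison Δ M) : EventualCondensate Δ M :=
  eventualCondensate_of_stiffness_densityResponse Δ M ρ hρ hlim hsect (uniformHelicityTensor_of_axial Δ M hS) hK hG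

/-- **THE ONE-STATE H0 ROTOR RUNG WITH PER-AXIS STIFFNESS:** along `ρ_L → ρ ∈ (0,1)`, «uniform twist stiffness in both
lattice directions (S_tw)^N + bounded density response (K′)^N + Gaussian domination of one conditional pair (H1⁗) ⇒ BEC»,
every hypothesis on ONE sector sequence; every analytic input (reflection symmetry, TWIST-IR incl. the Lieb–Robinson far
field, f-sum rule, LEMMA ZM, one-state E-floor) a tree theorem. [folklore] -/
theorem eventualCondensate_of_oneState_axial (Δ : ℝ) (M : ℕ → ℝ) (ρ : ℝ)
    (hρ : ρ ∈ Set.Ioo (0 : ℝ) 1)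
    (hlim : Tendsto (fun L : ℕ => 1 / 2 + M L / (L : ℝ) ^ 2) atTop (nhds ρ))
    (hS : AxialTwistStiffnessN Δ M) (hK : BoundedDensityResponseN Δ M)
    (hG : TeleGaussianComparison Δ M) : EventualCondensate Δ M :=
  eventualCondensate_of_oneState_stiffness Δ M ρ hρ hlim (uniformHelicityTensorN_of_axialN Δ M hS) hK hG

end Summit.HubbardSuperconductivity.HubbardSuperconductivity.Theorems.AnisotropyChord.Stiffness
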